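import Literature.NumberTheory.PAdicHodge.AinfWeierstrassOmegaPeriodAdd
import Literature.NumberTheory.PAdicHodge.AinfWeierstrassOmegaPeriodModFilTwo
import HarnessLib

/-!
# The Hodge–Tate class of a Tate-module point of `Ŵ`: `[t] mod Fil² ∈ gr¹B_dR⁺ ≅ ℂ_F(1)`, additive and `Γ_F`-equivariant

Topic `Literature/NumberTheory/PAdicHodge`; sequel of `AinfWeierstrassOmegaPeriodAdd` (`∫_{t⊕t'} ω = ∫_t ω + ∫_{t'} ω`) and
`AinfWeierstrassOmegaPeriodModFilTwo` (`∫_t ω ≡ [t] mod Fil²`). For an integral Weierstrass equation `W/ℤ`, a `p`-adic field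
`F` and a `[p]`-compatible torsion sequence `t` of `Ŵ(𝔪_{ℂ_F})`:

* `BdRPlusTop.grQuot F p` — `B_dR⁺/Fil²`, with the induced action `BdRPlusTop.galQuot σ` of `Γ_F`;
* **`htClass W t`** — the class of Fontaine's element `[t]` (equivalently of `∫_t ω`, `htClass_eq_omegaPeriod`) in
  `Fil¹/Fil² ⊂ B_dR⁺/Fil²`: the HODGE–TATE component of the period map of `Ŵ` (Tate 1967 §4; Fontaine 1982 §5);
* **`htClass_addSeq`** — additivity `HT(t ⊕ t') = HT(t) + HT(t')`; **`gal_htClass`** — `σ(HT(t)) = HT(σ t)`.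

So `t ↦ HT(t)` is a `Γ_F`-equivariant homomorphism `T_pŴ(𝒪_{ℂ_F}) → gr¹B_dR⁺(F) ≅ ℂ_F(1)`; Tate's theorem (its
injectivity on `ℤ_p`-points for `W` with good reduction — the non-degeneracy input of the supersingular sector of hDR) is
NOT proved here. Definitions (reviewed): `grQuot`, `galQuot`, `htClass`. No named facts, no `sorry`.

## References
* J. T. Tate, *p-divisible groups* (Driebergen 1966), Springer 1967, §4. [Tate1967]
* J.-M. Fontaine, *Formes différentielles et modules de Tate…*, Invent. Math. 65 (1982), §5. [Fontaine1982FormesDifferentielles]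
* J.-M. Fontaine, *Le corps des périodes p-adiques*, Astérisque 223 (1994), Exp. II §1.5. [FontaineAsterisque223III]
-/

noncomputable section

open Ideal Field WittVector MvPowerSeries

namespace Literature.NumberTheory.PAdicHodge

open Literature.NumberTheory.GaloisRepresentations
open Literature.NumberTheory.GaloisRepresentations.IsNonarchimedeanLocalField
open Literature.NumberTheory.GaloisRepresentations.LubinTate

variable (F : Type) [Field F] [ValuativeRel F] [TopologicalSpace F] [IsNonarchimedeanLocalField F] [CharZero F]
  (p : ℕ) [Fact p.Prime] [Fact (¬ IsUnit (p : integerC F))]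
  [IsAdicComplete (Ideal.span {(p : integerC F)}) (integerC F)]

namespace BdRPlusTop

/-- **`B_dR⁺/Fil²`** (the first-order neighbourhood of `θ`; `Fil¹/Fil² ≅ ℂ_F(1)` sits inside).
[cite: FontaineAsterisque223III, Exp. II §1.5] -/
abbrev grQuot : Type := BdRPlusTop F p ⧸ (WithIdeal.i ^ 2 : Ideal (BdRPlusTop F p))

/-- `σ` preserves `Fil²`. [cite: FontaineAsterisque223III, Exp. II §1.5] -/
theorem sq_le_comap_gal (σ : absoluteGaloisGroup F) :
    (WithIdeal.i ^ 2 : Ideal (BdRPlusTop F p)) ≤ (WithIdeal.i ^ 2 : Ideal (BdRPlusTop F p)).comap (gal F p σ) := by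
  rw [← Ideal.map_le_iff_le_comap, Ideal.map_pow]
  exact Ideal.pow_right_mono (ideal_map_gal_le σ) 2

/-- **The action of `σ ∈ Γ_F` on `B_dR⁺/Fil²`.** [cite: FontaineAsterisque223III, Exp. II §1.5] -/
def galQuot (σ : absoluteGaloisGroup F) : grQuot F p →+* grQuot F p :=
  Ideal.quotientMap _ (gal F p σ) (sq_le_comap_gal F p σ)

/-- `galQuot σ (x mod Fil²) = σ x mod Fil²`. [cite: FontaineAsterisque223III, Exp. II §1.5] -/
@[simp] theorem galQuot_mk (σ : absoluteGaloisGroup F) (x : BdRPlusTop F p) :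
    galQuot F p σ (Ideal.Quotient.mk _ x) = Ideal.Quotient.mk _ (gal F p σ x) :=
  Ideal.quotientMap_mk

end BdRPlusTop

namespace AinfTop

variable {F p}
variable {hθ : Function.Surjective (fontaineTheta (integerC F) p)} (W : WeierstrassCurve ℤ)

/-- **The Hodge–Tate class `HT(t) := [t] mod Fil² ∈ B_dR⁺/Fil²`** of a Tate-module point `t` of `Ŵ(𝒪_{ℂ_F})` (it lies in
`Fil¹/Fil² ≅ ℂ_F(1)`). [cite: Fontaine1982FormesDifferentielles, §5] [cite: Tate1967, §4] -/
def htClass (hθ : Function.Surjective (fontaineTheta (integerC F) p)) (t : ℕ → (maxNilIdealC F).toIdeal)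
    (ht0 : (t 0 : CBall F) = 0) (htp : ∀ n, mulPC F p W (t (n + 1)) = t n) : BdRPlusTop.grQuot F p :=
  Ideal.Quotient.mk _ (torsionLiftFil W hθ t ht0 htp : BdRPlusTop F p)

/-- **`HT(t) = ∫_t ω mod Fil²`.** [cite: Fontaine1982FormesDifferentielles, §5] -/
theorem htClass_eq_omegaPeriod {t : ℕ → (maxNilIdealC F).toIdeal} (ht0 : (t 0 : CBall F) = 0)
    (htp : ∀ n, mulPC F p W (t (n + 1)) = t n) :
    htClass W hθ t ht0 htp = Ideal.Quotient.mk _ (omegaPeriod W hθ t ht0 htp) := by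
  rw [htClass, Ideal.Quotient.eq, ← Ideal.neg_mem_iff, neg_sub]
  exact omegaPeriod_sub_torsionLiftFil_mem_sq W ht0 htp

/-- **Additivity `HT(t ⊕ t') = HT(t) + HT(t')`** (from `∫_{t⊕t'} ω = ∫_t ω + ∫_{t'} ω` and `∫ ≡ [·] mod Fil²`).
[cite: Fontaine1982FormesDifferentielles, §5] [cite: Tate1967, §4] -/
theorem htClass_addSeq {t t' : ℕ → (maxNilIdealC F).toIdeal} (ht0 : (t 0 : CBall F) = 0) (ht0' : (t' 0 : CBall F) = 0)
    (htp : ∀ n, mulPC F p W (t (n + 1)) = t n) (htp' : ∀ n, mulPC F p W (t' (n + 1)) = t' n) :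
    htClass W hθ (addSeq F W t t') (coe_addSeq_zero W ht0 ht0') (mulPC_addSeq W htp htp') =
      htClass W hθ t ht0 htp + htClass W hθ t' ht0' htp' := by
  rw [htClass_eq_omegaPeriod, htClass_eq_omegaPeriod, htClass_eq_omegaPeriod, omegaPeriod_addSeq W ht0 ht0' htp htp',
    map_add]

/-- **`Γ_F`-equivariance `σ(HT(t)) = HT(σ t)`.** [cite: Fontaine1982FormesDifferentielles, §5] [cite: Tate1967, §4] -/
theorem gal_htClass (σ : absoluteGaloisGroup F) {t : ℕ → (maxNilIdealC F).toIdeal} (ht0 : (t 0 : CBall F) = 0)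
    (htp : ∀ n, mulPC F p W (t (n + 1)) = t n) :
    BdRPlusTop.galQuot F p σ (htClass W hθ t ht0 htp) =
      htClass W hθ (galSeq F σ t) (coe_galSeq_zero σ ht0) (mulPC_galSeq W hθ σ htp) := by
  rw [htClass, htClass, BdRPlusTop.galQuot_mk, gal_torsionLiftFil W σ ht0 htp]

/-- `HT(t)` lies in `Fil¹/Fil²`: it is killed by (the class of) every element of `Fil¹`… concretely, `HT(t)·HT(t') = 0`
(products of two elements of `Fil¹` vanish mod `Fil²`). [cite: FontaineAsterisque223III, Exp. II §1.5] -/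
theorem htClass_mul_htClass {t t' : ℕ → (maxNilIdealC F).toIdeal} (ht0 : (t 0 : CBall F) = 0) (ht0' : (t' 0 : CBall F) = 0)
    (htp : ∀ n, mulPC F p W (t (n + 1)) = t n) (htp' : ∀ n, mulPC F p W (t' (n + 1)) = t' n) :
    htClass W hθ t ht0 htp * htClass W hθ t' ht0' htp' = 0 := by
  rw [htClass, htClass, ← map_mul, Ideal.Quotient.eq_zero_iff_mem, pow_two]
  exact Ideal.mul_mem_mul (torsionLiftFil W hθ t ht0 htp).2 (torsionLiftFil W hθ t' ht0' htp').2

end AinfTop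

end Literature.NumberTheory.PAdicHodge

end
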